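/-
COR-CM (cell pub-hodgecm2) — ¬hJ RUSH, HEAD-B (κ-line ∕ EDITION B), leaf 2∕3: TYPING.  Pen hmusep-p5 g3, 2026-08-24.
§4 the sub-socket `N₁₀ := ⨆_K genC ῑ₁ J' K (H^{1,0}(A_K ⊗_ῑ₁ ℂ))` — `act`-stable, DEEPLY of type (1,0) (identity-component restrictions at every
deep level lie in `H^{1,0}`: `res_{Γ_K} = t_1^* (alb K 1)^*` + Hodge functoriality of ✔ `BettiUniverse.pullHodgeHom`); §5 under the two
(P-K)-clauses at the Albanese varieties (hypotheses): `E(N₁₀)` DEEPLY (0,1), and `E ≠ 0` on `N₁₀` from `𝟙_{A_{K₀}} ≠ 0` (law (v′) + reality).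
THEOREMS (+ `abbrev`s, `def N10`, `def DeepTyped`, `def conjCoeff`); no named fact, no `sorry`, no new axiom.  FRAMING: HC_CM is NOT proved; nothing
here asserts hJ, hJ₀, (P-K) or their negations.
-/
import Summits.HodgeConjecture.CorCM.D2Bridge.NotHJKappaLift
import Summits.HodgeConjecture.HodgeCM.Model.LevelPullInjective
import Literature.AlgebraicGeometry.Motives.HodgeStructureWeil
import Literature.AlgebraicGeometry.Motives.AbelianVarietyProjectiveChart
import Literature.AlgebraicGeometry.HodgeTheory.AbelianVarietyHodgeNumbers
import Literature.AlgebraicGeometry.ComplexMultiplication.CMFieldActionHOne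
import HarnessLib

set_option autoImplicit false

/-!
# ¬hJ₀, HEAD-B (κ-line), leaf 2∕3: Hodge typing of the sub-socket

§4 the sub-socket `N₁₀ := ⨆_K genC ῑ₁ J' K (H^{1,0}(A_K ⊗_ῑ₁ ℂ))` is `act`-stable and deeply of type (1,0); §5 under the two (P-K)-clauses at the
Albanese varieties (hypotheses; supplied by the Literature row `ConjugateVarietySwapsHodgePieces`), `E(N₁₀)` is deeply of type (0,1) and `E`
is non-zero on `N₁₀` as soon as one `𝟙_{A_{K₀}} ≠ 0`.  HC_CM is NOT proved; nothing is asserted about hJ₀ or (P-K).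
-/

noncomputable section

namespace Summit.HodgeConjecture.CorCM.D2Bridge.NotHJ

open Function

/-! ## §1 The abstract lift (verbatim `DirectedSpanLift.lean`) -/

section Typed

open scoped TensorProduct
open CategoryTheory NumberField
open Literature.AlgebraicGeometry.Motives (AbelianVariety bettiCohomology baseChangeHom IsSmoothProjective HodgeStructure)
open Literature.AlgebraicGeometry.Motives.AbelianVariety (Hom.baseChange)
open Literature.AlgebraicGeometry.HodgeTheory
open Literature.AlgebraicGeometry.HodgeTheory.BettiUniverse (pull)
open Literature.AlgebraicGeometry.ShimuraVarieties.UnitaryCanonicalModel (exists_recordSystem)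
open Literature.NumberTheory.Automorphic Literature.NumberTheory.Automorphic.Liu2021 Literature.NumberTheory.Automorphic.Liu2021.AppendixC
open Literature.NumberTheory.Automorphic.PicardCM
open Literature.NumberTheory.Transcendental (Arapura2012_Cor_15_4_6)
open HodgeCM.Model.LevelTranslate HodgeCM.Model.TowerLevel HodgeCM.Model.TowerCarrier
open Summit.HodgeConjecture.CorCM.D2Bridge.TowerRational

variable {hHD : exists_isReal_hodgeModel} {hI : hodgePQ_independent_of_hodgeModel}
  {hU : BallQuotientUniformisedDatum} {h₃ : CMAbelianVarietyRealised} {hA : Arapura2012_Cor_15_4_6}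
variable {L : HodgeCM.CMField} {ι₁ : L →+* ℂ} {V : HodgeCM.HermSpace3 L ι₁} {h : exists_recordSystem}
  {Φ : Literature.AlgebraicGeometry.Motives.CMType L} {isotropicAt : ℕ → Prop}
  {C : Sec42Data (Model.honestP5Of h ⟨L.K⟩ ι₁ ⟨V.Hm, V.isHermitian, V.signature_ι₁, V.posDef_of_ne⟩ Φ) isotropicAt}
  {HT : C.HeckeTranslates}

/-- **The Hodge structure of `H¹(A_K ⊗_ι ℂ)` with THE witness of the (P-K) interface** (`baseChangeHom_holds ι isSmoothProjective_holds`,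
dimension index `dim A_K`) — so that (P-K) is consumed with no witness adapter. [cite: VoisinHodgeI2002, §7.1.1] -/
abbrev hodgeA (hHD : exists_isReal_hodgeModel)
    (C : Sec42Data (Model.honestP5Of h ⟨L.K⟩ ι₁ ⟨V.Hm, V.isHermitian, V.signature_ι₁, V.posDef_of_ne⟩ Φ) isotropicAt)
    (ι : L →+* ℂ) (K : C5.SmallLevel C.S.K₀) :=
  BettiUniverse.hodge hHD (IsSmoothProjective.baseChangeHom_holds ι (AbelianVariety.isSmoothProjective_holds (A := C.A K))) 1

/-- The tower's Hodge structure on a piece `P_Γ` (`universeOf.hodge`, unfolded). [folklore] -/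
abbrev hodgeP (hHD : exists_isReal_hodgeModel) (hI : hodgePQ_independent_of_hodgeModel)
    (hU : BallQuotientUniformisedDatum) (h₃ : CMAbelianVarietyRealised) (Γ : HodgeCM.Level V) :=
  (HodgeCM.Model.universeOf hHD hI hU h₃).hodge ((HodgeCM.Model.universeOf hHD hI hU h₃).pms L ι₁ V Γ) 1

/-! ### §4.1 Typing of generators -/

/-- `(alb K g)^*_ℂ` maps `H^{p,q}(A_K ⊗_ι ℂ)` into `H^{p,q}(P_{Γ_K,g})`. [cite: VoisinHodgeI2002, §7.3.2] -/
theorem albPull_mem_piece (ι : L →+* ℂ) (J : letI := ι.toAlgebra; ComponentAlbanese hHD hI hU h₃ hA V h Φ C HT)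
    (K : C5.SmallLevel C.S.K₀) (g : ↥V.adelicFin) {p q : ℤ} {w : ACx ι K} (hw : w ∈ (hodgeA hHD C ι K).piece p q) :
    (letI := ι.toAlgebra; (BettiUniverse.pull (J.alb K g) 1).baseChange ℂ) w ∈
      ((HodgeCM.Model.universeOf hHD hI hU h₃).hodge
          (.pms (HodgeCM.Model.pmsCode L ι₁ V ((letI := ι.toAlgebra; J.Γof K).conj g (letI := ι.toAlgebra; J.belowConjThree K)))) 1).piece p q := by
  letI := ι.toAlgebra
  exact (BettiUniverse.pullHodgeHom hHD hI (Var.isSmoothProjective hU h₃ _)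
    (IsSmoothProjective.baseChangeHom_holds ι (AbelianVariety.isSmoothProjective_holds (A := C.A K))) (J.alb K g) 1).map_piece_le p q
      (Submodule.mem_map_of_mem hw)

/-- Translate pull-backs `t_γ^*` between pieces preserve the Hodge pieces of `H¹`. [cite: VoisinHodgeI2002, §7.3.2] -/
theorem trPullQ_baseChange_mem_piece (γ : ↥(Urat V)) (Δ₁ Δ₂ : HodgeCM.Level V) (ht : TransCond (γ : GL (Fin 3) L) Δ₁ Δ₂)
    {p q : ℤ} {x : TensorProduct ℚ ℂ (CohQ hHD hI hU h₃ Δ₂ 1)} (hx : x ∈ (hodgeP hHD hI hU h₃ Δ₂).piece p q) :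
    (trPullQ hHD hI hU h₃ hA γ Δ₁ Δ₂ ht 1).baseChange ℂ x ∈ (hodgeP hHD hI hU h₃ Δ₁).piece p q :=
  (BettiUniverse.pullHodgeHom hHD hI (Var.isSmoothProjective hU h₃ _) (Var.isSmoothProjective hU h₃ _)
    (transMorU hU h₃ hHD hI hA γ.2 Δ₁ Δ₂ ht) 1).map_piece_le p q (Submodule.mem_map_of_mem hx)

/-- Level-covering pull-backs preserve the Hodge pieces of `H¹`. [cite: VoisinHodgeI2002, §7.3.2] -/
theorem levelCover_pullC_mem_piece {Γ Γ' : HodgeCM.Level V} (hle : Γ' ≤ Γ) {p q : ℤ}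
    {x : (HodgeCM.Model.universeOf hHD hI hU h₃).CohC ((HodgeCM.Model.universeOf hHD hI hU h₃).pms L ι₁ V Γ) 1}
    (hx : x ∈ (hodgeP hHD hI hU h₃ Γ).piece p q) :
    (HodgeCM.Model.universeOf hHD hI hU h₃).pullC (X := (HodgeCM.Model.universeOf hHD hI hU h₃).pms L ι₁ V Γ')
        (Y := (HodgeCM.Model.universeOf hHD hI hU h₃).pms L ι₁ V Γ)
        (HodgeCM.Model.levelCover hU h₃ hHD hA Γ Γ' (HodgeCM.Level.Γ_mono hle)) 1 x ∈ (hodgeP hHD hI hU h₃ Γ').piece p q :=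
  (BettiUniverse.pullHodgeHom hHD hI (Var.isSmoothProjective hU h₃ _) (Var.isSmoothProjective hU h₃ _)
    (HodgeCM.Model.levelCover hU h₃ hHD hA Γ Γ' (HodgeCM.Level.Γ_mono hle)) 1).map_piece_le p q (Submodule.mem_map_of_mem hx)

/-- The rational identity-component value of the family `J^*_K x` is `t_1^* ((alb K 1)^* x)` (by `rfl`). [folklore] -/
theorem resQ_comp_albStarQ [Algebra L ℂ] (J : ComponentAlbanese hHD hI hU h₃ hA V h Φ C HT) (K : C5.SmallLevel C.S.K₀) :
    resQ hHD hI hU h₃ hA (J.Γof K) (J.belowConjThree K) ∘ₗ J.albStarQ K =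
      trPullQ hHD hI hU h₃ hA 1 (J.Γof K) ((J.Γof K).conj 1 (J.belowConjThree K))
          (transCond_one_of_eq (HodgeCM.Level.conj_one (J.Γof K) (J.belowConjThree K)).symm) 1 ∘ₗ
        BettiUniverse.pull (J.alb K 1) 1 :=
  rfl

/-- **Typing of a generator at its own level**: for `w ∈ H^{p,q}(A_K ⊗_ι ℂ)`, `res_{Γ_K} (genC ι J K w) ∈ H^{p,q}(P_{Γ_K})`.
[cite: VoisinHodgeI2002, §7.3.2] [cite: Liu2021, §4.2 (FJcycle.tex l. 2062–2074)] -/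
theorem res_genC_mem_piece (ι : L →+* ℂ) (J : letI := ι.toAlgebra; ComponentAlbanese hHD hI hU h₃ hA V h Φ C HT)
    (K : C5.SmallLevel C.S.K₀) {p q : ℤ} {w : ACx ι K} (hw : w ∈ (hodgeA hHD C ι K).piece p q) :
    HodgeCM.Model.TowerCarrier.res hHD hI hU h₃ hA (letI := ι.toAlgebra; J.Γof K) (letI := ι.toAlgebra; J.belowConjThree K)
        (genC ι J K w) ∈ (hodgeP hHD hI hU h₃ (letI := ι.toAlgebra; J.Γof K)).piece p q := by
  letI := ι.toAlgebra
  show HodgeCM.Model.TowerCarrier.res hHD hI hU h₃ hA (J.Γof K) (J.belowConjThree K)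
      (ιT hHD hI hU h₃ hA V ((ofQ hHD hI hU h₃ hA (J.Γof K) (J.belowConjThree K) ∘ₗ J.albStarQ K).baseChange ℂ w)) ∈ _
  rw [LinearMap.baseChange_comp, LinearMap.comp_apply, ← resTotal_of hHD hI hU h₃ hA (J.Γof K) (J.belowConjThree K),
    resTotal_ιT_baseChange_ofQ, ← LinearMap.comp_apply, ← LinearMap.baseChange_comp, resQ_comp_albStarQ,
    LinearMap.baseChange_comp, LinearMap.comp_apply]
  exact trPullQ_baseChange_mem_piece 1 _ _ _ (albPull_mem_piece ι J K 1 hw)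

/-- The generator `genC ι J K w` is the image of a level-`Γ_K` family (`levelImage`). [folklore] -/
theorem genC_mem_levelImage (ι : L →+* ℂ) (J : letI := ι.toAlgebra; ComponentAlbanese hHD hI hU h₃ hA V h Φ C HT)
    (K : C5.SmallLevel C.S.K₀) (w : ACx ι K) :
    genC ι J K w ∈ levelImage hHD hI hU h₃ hA (letI := ι.toAlgebra; J.Γof K) (letI := ι.toAlgebra; J.belowConjThree K) := by
  letI := ι.toAlgebra
  show ιT hHD hI hU h₃ hA V ((ofQ hHD hI hU h₃ hA (J.Γof K) (J.belowConjThree K) ∘ₗ J.albStarQ K).baseChange ℂ w) ∈ _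
  rw [LinearMap.baseChange_comp, LinearMap.comp_apply, ιT_baseChange_ofQ]
  exact LinearMap.mem_range_self _ _

/-! ### §4.2 Deep typing -/

variable (hHD hI hU h₃ hA V) in
/-- **`x` is DEEPLY of type `(p,q)`**: below some tower level its identity-component restrictions all lie in `H^{p,q}` (nothj-p4's `typing`,
nothj-p5's `IsEvTyped` without the residence clause). [folklore] -/
def DeepTyped (p q : ℤ) (x : Tower hHD hI hU h₃ hA V) : Prop :=
  ∃ (Γ₁ : HodgeCM.Level V), Γ₁.BelowConjThree ∧ ∀ (Γ : HodgeCM.Level V) (hΓ : Γ.BelowConjThree), Γ ≤ Γ₁ →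
    HodgeCM.Model.TowerCarrier.res hHD hI hU h₃ hA Γ hΓ x ∈ (hodgeP hHD hI hU h₃ Γ).piece p q

/-- `0` is deeply typed. [folklore] -/
theorem deepTyped_zero (p q : ℤ) : DeepTyped hHD hI hU h₃ hA V p q 0 :=
  ⟨HodgeCM.Level.three V, HodgeCM.Level.BelowConjThree.three, fun Γ hΓ _ => by rw [map_zero]; exact Submodule.zero_mem _⟩

/-- Deep typing is closed under addition (meet of the thresholds). [folklore] -/
theorem DeepTyped.add {p q : ℤ} {x y : Tower hHD hI hU h₃ hA V} (hx : DeepTyped hHD hI hU h₃ hA V p q x)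
    (hy : DeepTyped hHD hI hU h₃ hA V p q y) : DeepTyped hHD hI hU h₃ hA V p q (x + y) := by
  obtain ⟨Γx, hΓx, hx⟩ := hx
  obtain ⟨Γy, -, hy⟩ := hy
  refine ⟨Γx ⊓ Γy, hΓx.of_le inf_le_left, fun Γ hΓ hle => ?_⟩
  rw [map_add]
  exact Submodule.add_mem _ (hx Γ hΓ (hle.trans inf_le_left)) (hy Γ hΓ (hle.trans inf_le_right))

/-- Deep typing is closed under scalars. [folklore] -/
theorem DeepTyped.smul {p q : ℤ} (c : ℂ) {x : Tower hHD hI hU h₃ hA V} (hx : DeepTyped hHD hI hU h₃ hA V p q x) :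
    DeepTyped hHD hI hU h₃ hA V p q (c • x) := by
  obtain ⟨Γx, hΓx, hx⟩ := hx
  refine ⟨Γx, hΓx, fun Γ hΓ hle => ?_⟩
  rw [map_smul]
  exact Submodule.smul_mem _ c (hx Γ hΓ hle)

/-- **A generator typed at its own level is deeply typed** (pull back along the level coverings). [cite: VoisinHodgeI2002, §7.3.2] -/
theorem deepTyped_genC (ι : L →+* ℂ) (J : letI := ι.toAlgebra; ComponentAlbanese hHD hI hU h₃ hA V h Φ C HT)
    (K : C5.SmallLevel C.S.K₀) {p q : ℤ} {w : ACx ι K} (hw : w ∈ (hodgeA hHD C ι K).piece p q) :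
    DeepTyped hHD hI hU h₃ hA V p q (genC ι J K w) := by
  letI := ι.toAlgebra
  refine ⟨J.Γof K, J.belowConjThree K, fun Γ hΓ hle => ?_⟩
  obtain ⟨c, hc⟩ := genC_mem_levelImage ι J K w
  have h0 := res_genC_mem_piece ι J K hw
  rw [← hc] at h0 ⊢
  rw [res_ofLevel_of_le hHD hI hU h₃ hA hle (J.belowConjThree K) hΓ c]
  exact levelCover_pullC_mem_piece hle h0

/-! ### §4.3 The sub-socket `N₁₀` -/

/-- **`N₁₀(J') := ⨆_K genC ῑ₁ J' K (H^{1,0}(A_K ⊗_ῑ₁ ℂ))`** — the pin's images of the (1,0)-classes of all the Albanese varieties.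
[cite: Liu2021, §4.2 (FJcycle.tex l. 2062–2074)] -/
def N10 (J' : letI := (conjEmb ι₁).toAlgebra; ComponentAlbanese hHD hI hU h₃ hA V h Φ C HT) : Submodule ℂ (Tower hHD hI hU h₃ hA V) :=
  ⨆ K : C5.SmallLevel C.S.K₀, ((hodgeA hHD C (conjEmb ι₁) K).piece 1 0).map (genC (conjEmb ι₁) J' K)

/-- `N₁₀ ≤ N_ℂ`. [folklore] -/
theorem N10_le_pinSpanC (J' : letI := (conjEmb ι₁).toAlgebra; ComponentAlbanese hHD hI hU h₃ hA V h Φ C HT) :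
    N10 J' ≤ pinSpanC J' :=
  iSup_le fun K => (Submodule.map_mono le_top).trans (by rw [Submodule.map_top]; exact le_iSup (fun K => LinearMap.range (genC (conjEmb ι₁) J' K)) K)

/-- Every vector of `N₁₀` is deeply of type `(1,0)`. [cite: VoisinHodgeI2002, §7.3.2] -/
theorem deepTyped_of_mem_N10 (J' : letI := (conjEmb ι₁).toAlgebra; ComponentAlbanese hHD hI hU h₃ hA V h Φ C HT)
    {x : Tower hHD hI hU h₃ hA V} (hx : x ∈ N10 J') : DeepTyped hHD hI hU h₃ hA V 1 0 x := by
  refine Submodule.iSup_induction (fun K => ((hodgeA hHD C (conjEmb ι₁) K).piece 1 0).map (genC (conjEmb ι₁) J' K))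
    (motive := fun x => DeepTyped hHD hI hU h₃ hA V 1 0 x) hx ?_ (deepTyped_zero 1 0) (fun x y => DeepTyped.add)
  rintro K _ ⟨w, hw, rfl⟩
  exact deepTyped_genC (conjEmb ι₁) J' K hw

/-- `N₁₀` is stable under every Hecke operator `act g` (law (iv) + `(Alb T_g)^*_ℂ` preserves `H^{1,0}`). [cite: VoisinHodgeI2002, §7.3.2] -/
theorem act_mem_N10 (J' : letI := (conjEmb ι₁).toAlgebra; ComponentAlbanese hHD hI hU h₃ hA V h Φ C HT) (g : ↥V.adelicFin)
    {x : Tower hHD hI hU h₃ hA V} (hx : x ∈ N10 J') : act hHD hI hU h₃ hA g x ∈ N10 J' := by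
  refine Submodule.iSup_induction (fun K => ((hodgeA hHD C (conjEmb ι₁) K).piece 1 0).map (genC (conjEmb ι₁) J' K))
    (motive := fun x => act hHD hI hU h₃ hA g x ∈ N10 J') hx ?_ (by rw [map_zero]; exact Submodule.zero_mem _)
    (fun x y hx hy => by rw [map_add]; exact Submodule.add_mem _ hx hy)
  rintro K _ ⟨w, hw, rfl⟩
  rw [act_genC]
  refine Submodule.mem_iSup_of_mem (C5.heckeLevel g K) ⟨_, ?_, rfl⟩
  letI := (conjEmb ι₁).toAlgebra
  exact (BettiUniverse.pullHodgeHom hHD hI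
    (IsSmoothProjective.baseChangeHom_holds (conjEmb ι₁) (AbelianVariety.isSmoothProjective_holds (A := C.A (C5.heckeLevel g K))))
    (IsSmoothProjective.baseChangeHom_holds (conjEmb ι₁) (AbelianVariety.isSmoothProjective_holds (A := C.A K)))
    (Hom.baseChange ℂ (HT.albTr g (C5.heckeLevel g K) K (C5.heckeLE_heckeLevel g K))).hom.hom.hom 1).map_piece_le 1 0
      (Submodule.mem_map_of_mem hw)

end Typed

section PK

open scoped TensorProduct
open CategoryTheory NumberField
open Literature.AlgebraicGeometry.Motives (AbelianVariety bettiCohomology baseChangeHom IsSmoothProjective HodgeStructure SchemeOver)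
open Literature.AlgebraicGeometry.Motives.AbelianVariety (Hom.baseChange)
open Literature.AlgebraicGeometry.HodgeTheory
open Literature.AlgebraicGeometry.HodgeTheory.BettiUniverse (pull)
open Literature.AlgebraicGeometry.ShimuraVarieties.UnitaryCanonicalModel (exists_recordSystem)
open Literature.NumberTheory.Automorphic Literature.NumberTheory.Automorphic.Liu2021 Literature.NumberTheory.Automorphic.Liu2021.AppendixC
open Literature.NumberTheory.Automorphic.PicardCM
open Literature.NumberTheory.Transcendental (Arapura2012_Cor_15_4_6)
open HodgeCM.Model.LevelTranslate HodgeCM.Model.TowerLevel HodgeCM.Model.TowerCarrier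
open Summit.HodgeConjecture.CorCM.D2Bridge.TowerRational

variable {hHD : exists_isReal_hodgeModel} {hI : hodgePQ_independent_of_hodgeModel}
  {hU : BallQuotientUniformisedDatum} {h₃ : CMAbelianVarietyRealised} {hA : Arapura2012_Cor_15_4_6}
variable {L : HodgeCM.CMField} {ι₁ : L →+* ℂ} {V : HodgeCM.HermSpace3 L ι₁} {h : exists_recordSystem}
  {Φ : Literature.AlgebraicGeometry.Motives.CMType L} {isotropicAt : ℕ → Prop}
  {C : Sec42Data (Model.honestP5Of h ⟨L.K⟩ ι₁ ⟨V.Hm, V.isHermitian, V.signature_ι₁, V.posDef_of_ne⟩ Φ) isotropicAt}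
  {HT : C.HeckeTranslates}

/-- `κ⁻¹ (κ w) = w`, complexified. [folklore] -/
theorem kappaInvC_kappaC (K : C5.SmallLevel C.S.K₀) (w : ACx (C := C) ι₁ K) :
    kappaInvC K (((bettiConjLinearEquiv ι₁ (C.A K).X 1).toLinearMap.baseChange ℂ) w) = w := by
  have key : (bettiConjLinearEquiv ι₁ (C.A K).X 1).symm.toLinearMap ∘ₗ (bettiConjLinearEquiv ι₁ (C.A K).X 1).toLinearMap =
      LinearMap.id := LinearMap.ext fun z => (bettiConjLinearEquiv ι₁ (C.A K).X 1).symm_apply_apply z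
  have := (baseChange_comp_apply' (bettiConjLinearEquiv ι₁ (C.A K).X 1).symm.toLinearMap
    (bettiConjLinearEquiv ι₁ (C.A K).X 1).toLinearMap w).symm
  rw [key, LinearMap.baseChange_id, LinearMap.id_apply] at this
  exact this

/-- **`E(N₁₀)` is deeply of type (0,1)** (under (P-K)): on a generator, `E (genC ῑ₁ J' K w) = genC ι₁ J₁ K (κ⁻¹ w)` with `κ⁻¹ w ∈ H^{0,1}`.
[cite: DeligneEtAl1982, I §1] [cite: VoisinHodgeI2002, §7.3.2] -/
theorem deepTyped_E_of_mem_N10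
    (hPK₂ : ∀ (K : C5.SmallLevel C.S.K₀) (w : ACx (C := C) (conjEmb ι₁) K),
      w ∈ (hodgeA hHD C (conjEmb ι₁) K).piece 1 0 → kappaInvC K w ∈ (hodgeA hHD C ι₁ K).piece 0 1)
    (J' : letI := (conjEmb ι₁).toAlgebra; ComponentAlbanese hHD hI hU h₃ hA V h Φ C HT)
    (J₁ : letI := ι₁.toAlgebra; ComponentAlbanese hHD hI hU h₃ hA V h Φ C HT)
    (E : pinSpanC J' →ₗ[ℂ] Tower hHD hI hU h₃ hA V)
    (hE : ∀ (K : C5.SmallLevel C.S.K₀) (w : ACx (conjEmb ι₁) K) (hw : genC (conjEmb ι₁) J' K w ∈ pinSpanC J'),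
      E ⟨genC (conjEmb ι₁) J' K w, hw⟩ = genC ι₁ J₁ K (kappaInvC K w))
    {x : Tower hHD hI hU h₃ hA V} (hx : x ∈ N10 J') (hx' : x ∈ pinSpanC J') :
    DeepTyped hHD hI hU h₃ hA V 0 1 (E ⟨x, hx'⟩) := by
  suffices hmain : ∃ hx'' : x ∈ pinSpanC J', DeepTyped hHD hI hU h₃ hA V 0 1 (E ⟨x, hx''⟩) by
    obtain ⟨hx'', d⟩ := hmain
    exact d
  refine Submodule.iSup_induction (fun K => ((hodgeA hHD C (conjEmb ι₁) K).piece 1 0).map (genC (conjEmb ι₁) J' K))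
    (motive := fun x => ∃ hx'' : x ∈ pinSpanC J', DeepTyped hHD hI hU h₃ hA V 0 1 (E ⟨x, hx''⟩)) hx ?_ ?_ ?_
  · rintro K _ ⟨w, hw, rfl⟩
    refine ⟨N10_le_pinSpanC J' (Submodule.mem_iSup_of_mem K ⟨w, hw, rfl⟩), ?_⟩
    rw [hE]
    exact deepTyped_genC ι₁ J₁ K (hPK₂ K w hw)
  · refine ⟨Submodule.zero_mem _, ?_⟩
    have : (⟨0, Submodule.zero_mem _⟩ : pinSpanC J') = 0 := rfl
    rw [this, map_zero]
    exact deepTyped_zero 0 1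
  · rintro x y ⟨hx'', dx⟩ ⟨hy'', dy⟩
    refine ⟨Submodule.add_mem _ hx'' hy'', ?_⟩
    have : (⟨x + y, Submodule.add_mem _ hx'' hy''⟩ : pinSpanC J') = ⟨x, hx''⟩ + ⟨y, hy''⟩ := rfl
    rw [this, map_add]
    exact dx.add dy

/-- Coefficient conjugation on `ℂ ⊗_ℚ N` for any `ℚ`-module `N` (the formula of `HodgeStructure.conj`). [folklore] -/
def conjCoeff (N : Type*) [AddCommMonoid N] [Module ℚ N] : TensorProduct ℚ ℂ N →ₗ[ℚ] TensorProduct ℚ ℂ N :=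
  (Complex.conjAe.toLinearMap.restrictScalars ℚ).rTensor N

/-- Naturality of coefficient conjugation: `conj (f ⊗ ℂ · x) = f ⊗ ℂ · (conj x)`. [folklore] -/
theorem conjCoeff_baseChange {M N : Type*} [AddCommGroup M] [Module ℚ M] [AddCommMonoid N] [Module ℚ N]
    (f : M →ₗ[ℚ] N) (x : TensorProduct ℚ ℂ M) :
    conjCoeff N (f.baseChange ℂ x) = f.baseChange ℂ (HodgeStructure.conj x) := by
  induction x using TensorProduct.induction_on with
  | zero => simp only [map_zero]
  | tmul a m =>
    rw [LinearMap.baseChange_tmul, HodgeStructure.conj_tmul, LinearMap.baseChange_tmul]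
    rfl
  | add x y hx hy => simp only [map_add, hx, hy]

/-- **A rational map read injectively into a `ℂ`-space sees the `(0,1)`-piece of an effective weight-one Hodge structure**: if
`ι ∘ (f ⊗ ℂ)` vanished on `V^{0,1}` it would vanish on `V^{1,0} = conj V^{0,1}` too (`f ⊗ ℂ` commutes with coefficient conjugation, `ι` is
injective), hence everywhere. [cite: VoisinHodgeI2002, §7.1.1] -/
theorem exists_mem_piece01_ne_zero {M N T : Type*} [AddCommGroup M] [Module ℚ M] [AddCommMonoid N] [Module ℚ N]
    [AddCommMonoid T] [Module ℂ T]
    (H : HodgeStructure M 1) (hH : H.IsEffective) (f : M →ₗ[ℚ] N) (ι : TensorProduct ℚ ℂ N →ₗ[ℂ] T) (hι : Function.Injective ι)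
    (m₀ : M) (h0 : ι (f.baseChange ℂ (TensorProduct.tmul ℚ (1 : ℂ) m₀)) ≠ 0) :
    ∃ w ∈ H.piece 0 1, ι (f.baseChange ℂ w) ≠ 0 := by
  by_contra hcon
  push Not at hcon
  apply h0
  have h01 : ∀ w ∈ H.piece 0 1, f.baseChange ℂ w = 0 := fun w hw => hι ((hcon w hw).trans (map_zero ι).symm)
  have h10 : ∀ w ∈ H.piece 1 0, f.baseChange ℂ w = 0 := by
    intro w hw
    have hu : HodgeStructure.conj w ∈ H.piece 0 1 := HodgeStructure.conj_mem_piece H hw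
    have h1 : f.baseChange ℂ (HodgeStructure.conj (HodgeStructure.conj w)) = 0 := by
      rw [← conjCoeff_baseChange, h01 _ hu, map_zero]
    rwa [HodgeStructure.conj_conj] at h1
  have htop : ∀ w : TensorProduct ℚ ℂ M, f.baseChange ℂ w = 0 := by
    intro w
    have hw : w ∈ H.piece 1 0 ⊔ H.piece 0 1 := by
      rw [(isCompl_piece_one_zero_piece_zero_one H hH).sup_eq_top]; exact Submodule.mem_top
    obtain ⟨a, ha, b, hb, rfl⟩ := Submodule.mem_sup.1 hw
    rw [map_add, h10 a ha, h01 b hb, add_zero]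
  rw [htop, map_zero]

/-- **`𝟙_{A_K} ≠ 0 ⇒ J^*_K x ≠ 0` for some rational class `x`** (law (v′) `alb_detect` at `φ := 𝟙`; nothj-p5's `albStarQ_ne_zero_of_one_ne_zero`,
re-derived). [cite: Liu2021, proof of Lemma 2.4 (1) (FJcycle.tex l. 1220–1228)] -/
theorem exists_albStarQ_ne_zero [Algebra L ℂ] (J : ComponentAlbanese hHD hI hU h₃ hA V h Φ C HT) (K : C5.SmallLevel C.S.K₀)
    (h1 : (𝟙 (C.A K) : C.A K ⟶ C.A K) ≠ 0) : ∃ x : bettiCohomology ((C.A K).baseChange ℂ).X 1, J.albStarQ K x ≠ 0 := by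
  obtain ⟨g, hg⟩ := J.alb_detect K (𝟙 (C.A K)) h1
  rw [AbelianVariety.Hom.baseChange_id] at hg
  have hg' : pull (J.alb K g) 1 ≠ 0 := by
    intro h0'
    apply hg
    change pull (J.alb K g ≫ 𝟙 _) 1 = 0
    rw [Category.comp_id]
    exact h0'
  by_contra hcon
  push Not at hcon
  apply hg'
  ext x
  have hx := congrArg (fun c : levelQ hHD hI hU h₃ hA (J.Γof K) (J.belowConjThree K) =>
    (c : Π g : ↥V.adelicFin, WQ hHD hI hU h₃ (J.Γof K) (J.belowConjThree K) g) g) (hcon x)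
  simp only [Submodule.coe_zero, Pi.zero_apply] at hx
  rw [LinearMap.zero_apply]
  exact hx

/-- **Non-vanishing of `E` on `N₁₀`** (under (P-K) and `𝟙_{A_{K₀}} ≠ 0`): there is a vector of `N₁₀` on which `E` is non-zero.
[cite: Liu2021, proof of Lemma 2.4 (1)] [cite: DeligneEtAl1982, I §1] -/
theorem exists_mem_N10_E_ne_zero
    (hPK₁ : ∀ (K : C5.SmallLevel C.S.K₀) (w : ACx (C := C) ι₁ K), w ∈ (hodgeA hHD C ι₁ K).piece 0 1 →
      ((bettiConjLinearEquiv ι₁ (C.A K).X 1).toLinearMap.baseChange ℂ) w ∈ (hodgeA hHD C (conjEmb ι₁) K).piece 1 0)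
    (J' : letI := (conjEmb ι₁).toAlgebra; ComponentAlbanese hHD hI hU h₃ hA V h Φ C HT)
    (J₁ : letI := ι₁.toAlgebra; ComponentAlbanese hHD hI hU h₃ hA V h Φ C HT)
    (E : pinSpanC J' →ₗ[ℂ] Tower hHD hI hU h₃ hA V)
    (hE : ∀ (K : C5.SmallLevel C.S.K₀) (w : ACx (conjEmb ι₁) K) (hw : genC (conjEmb ι₁) J' K w ∈ pinSpanC J'),
      E ⟨genC (conjEmb ι₁) J' K w, hw⟩ = genC ι₁ J₁ K (kappaInvC K w))
    {K₀ : C5.SmallLevel C.S.K₀} (h1 : (𝟙 (C.A K₀) : C.A K₀ ⟶ C.A K₀) ≠ 0) :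
    ∃ (x : Tower hHD hI hU h₃ hA V) (hx' : x ∈ pinSpanC J'), x ∈ N10 J' ∧ E ⟨x, hx'⟩ ≠ 0 := by
  letI := ι₁.toAlgebra
  obtain ⟨x₀, hx₀⟩ := exists_albStarQ_ne_zero J₁ K₀ h1
  -- `genC ι₁ J₁ K₀ (1 ⊗ x₀) = jQ (genAt x₀) ≠ 0`
  have hg : genAt ι₁ J₁ K₀ x₀ ≠ 0 := fun h0 =>
    hx₀ (ofQ_injective hHD hI hU h₃ hA (J₁.Γof K₀) (J₁.belowConjThree K₀) (h0.trans (map_zero _).symm))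
  have h0 : ιT hHD hI hU h₃ hA V ((genAt ι₁ J₁ K₀).baseChange ℂ (TensorProduct.tmul ℚ (1 : ℂ) x₀)) ≠ 0 := by
    rw [LinearMap.baseChange_tmul, ιT_tmul, one_smul]
    exact fun h0 => hg (jQ_injective hHD hI hU h₃ hA (h0.trans (map_zero _).symm))
  -- a (0,1)-class on which `genC ι₁ J₁ K₀` does not vanish
  obtain ⟨w, hw, hne'⟩ := exists_mem_piece01_ne_zero (hodgeA hHD C ι₁ K₀) (BettiUniverse.hodge_isEffective hHD _ 1)
    (genAt ι₁ J₁ K₀) (ιT hHD hI hU h₃ hA V) (ιT_injective hHD hI hU h₃ hA V) x₀ h0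
  change genC ι₁ J₁ K₀ w ≠ 0 at hne'
  -- transport it to the `ῑ₁` side by `κ`: a (1,0)-class, preimage of `w` under `κ⁻¹`
  let w' : ACx (C := C) (conjEmb ι₁) K₀ := ((bettiConjLinearEquiv ι₁ (C.A K₀).X 1).toLinearMap.baseChange ℂ) w
  have hw' : w' ∈ (hodgeA hHD C (conjEmb ι₁) K₀).piece 1 0 := hPK₁ K₀ w hw
  have hmem : genC (conjEmb ι₁) J' K₀ w' ∈ N10 J' := Submodule.mem_iSup_of_mem K₀ ⟨w', hw', rfl⟩
  refine ⟨genC (conjEmb ι₁) J' K₀ w', N10_le_pinSpanC J' hmem, hmem, ?_⟩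
  rw [hE, kappaInvC_kappaC]
  exact hne'

end PK

end Summit.HodgeConjecture.CorCM.D2Bridge.NotHJ

end
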